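import Literature.Topology.FourManifolds.LefschetzBasePages
import Literature.Topology.FourManifolds.TorusKnotMilnorFibreHomology
import HarnessLib

/-!
# The standard Lefschetz base of genus `g`, V: the piece `V` of the Milnor cover is `≃ₕ Fin (2g+1)`

Topic `Literature/Topology/FourManifolds`; namespace `Literature.Topology.FourManifolds.LefschetzBase`.
Sequel of `LefschetzBaseCover.lean` (the cover `Base g = U ∪ V`, `U = {Re x^{2g+1} > −3/8}`,
`V = {Re x^{2g+1} < −1/4}`, and `U ≃ₕ Fin 2`), written so as not to import it (the set `V` is
spelled out; the bookkeeping lemmas of its §8 are repeated as `private` copies).  Everything here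
is PROVED; nothing is asserted.

* §10 on `V`, `Re (−x^{2g+1}) > 1/4`; the SECTOR ROOT `angV = x / (ν (−x^{2g+1})^{1/(2g+1)})`
  (`ν = e^{iπ/(2g+1)}`; a `(2g+1)`-st root of unity) is locally constant, and
  `(x, y) ↦ (angV · ν · (1 − t²(x^{2g+1} + 1))^{1/(2g+1)}, t y)` deformation retracts `V` onto the
  `2g+1` branch points `(ζ_k, 0)`, `ζ_k = ν μ^k = e^{iπ(2k+1)/(2g+1)}` (= `branchPt g k`), of the
  central page: **`homotopyEquivV : V ≃ₕ Fin (2g+1)`** (index map `idxV`, `idxV_apply`; section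
  `secV`) (Milnor 1968, Lemma 9.2: the fibre retracts onto the join of the roots; here one piece
  of the thickened fibre onto one set of roots);
* §11 `joined_branchPt_axis`: the radial lift `r ↦ ((1−r) ζ, ±√(1 − (1−r)^{2g+1}))` joins the
  branch point `(ζ, 0)` to `(0, ±1)` inside the base (for path-connectedness downstream).

## References
* J. Milnor, *Singular points of complex hypersurfaces*, Ann. of Math. Studies 61 (1968), §9,
  Thm. 9.1, Lemma 9.2. [Milnor1968]
* A. Hatcher, *Algebraic Topology*, CUP 2002, §2.2 pp. 149–150 (Mayer–Vietoris). [HatcherAT2002]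
-/

noncomputable section

open scoped Manifold ContDiff Topology
open Set Function Metric
open Literature.Topology.FourManifolds.TorusKnotMilnor

namespace Literature.Topology.FourManifolds

/-- Local notation: `𝔼 n` is the model Euclidean space `EuclideanSpace ℝ (Fin n)`. -/
local notation "𝔼 " n:arg => EuclideanSpace ℝ (Fin n)

namespace LefschetzBase

variable {g : ℕ}

-- Local notation: the piece `V` (`coverV g` of `LefschetzBaseCover.lean`), written out.
set_option quotPrecheck false in
local notation "𝒱 " g:arg => ({p : Base g | (cx p.1 ^ (2 * g + 1)).re < -(1 / 4 : ℝ)} : Set (Base g))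

/-! ## §10a Private copies (suffix `V`) of the bookkeeping lemmas of `LefschetzBaseCover.lean` -/

/-- `x^{2g+1}` is continuous on the base. [folklore] -/
private theorem continuous_xPowV (g : ℕ) : Continuous fun p : Base g => cx p.1 ^ (2 * g + 1) :=
  (contDiff_cx.continuous.comp continuous_subtype_val).pow _

/-- `rho` in complex coordinates. [folklore] -/
private theorem rho_mkV' (g : ℕ) (a b : ℂ) :
    rho g (mk a b) = ‖b ^ 2 - a ^ (2 * g + 1) - 1‖ ^ 2 + eta (‖a‖ ^ 2) := by
  simp only [rho, w, Phi, cx_mk, cy_mk]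

/-- `w = y² − x^{2g+1} − 1`. [folklore] -/
private theorem w_eqV' (g : ℕ) (q : 𝔼 4) : w g q = cy q ^ 2 - cx q ^ (2 * g + 1) - 1 := rfl

/-- `y² = x^{2g+1} + 1 + w`. [folklore] -/
private theorem cy_sq_eqV (g : ℕ) (q : 𝔼 4) : cy q ^ 2 = cx q ^ (2 * g + 1) + 1 + w g q := by
  rw [w_eqV']; ring

/-- On the base `‖w‖ ≤ 1/2`. [folklore] -/
private theorem norm_w_leV (p : Base g) : ‖w g p.1‖ ≤ 1 / 2 := by
  nlinarith [(bounds_of_rho_le g p.2).2, norm_nonneg (w g p.1)]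

/-- `eta` bookkeeping: if `‖a'‖^{n+1} ≤ max 1 ‖a‖^{n+1}` then `eta ‖a'‖² ≤ eta ‖a‖²` (`eta` is
monotone and vanishes below `4`). [folklore] -/
private theorem eta_le_of_pow_leV {a b : ℝ} (ha : 0 ≤ a) (hb : 0 ≤ b) {n : ℕ}
    (h : a ^ (n + 1) ≤ max 1 (b ^ (n + 1))) : eta (a ^ 2) ≤ eta (b ^ 2) := by
  rcases le_total 1 b with hb1 | hb1
  · rw [max_eq_right (one_le_pow₀ hb1)] at h
    have hab : a ≤ b := le_of_pow_le_pow_left₀ (Nat.succ_ne_zero n) hb h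
    exact eta_monotone (by nlinarith)
  · rw [max_eq_left (pow_le_one₀ hb hb1)] at h
    have ha1 : a ≤ 1 := le_of_pow_le_pow_left₀ (Nat.succ_ne_zero n) zero_le_one (by rwa [one_pow])
    rw [eta_of_le (by nlinarith)]
    exact eta_nonneg _

/-- A convex combination of `1` and `c ≥ 0` is at most `max 1 c`. [folklore] -/
private theorem convex_comb_le_maxV {s c : ℝ} (hs0 : 0 ≤ s) (hs1 : s ≤ 1) :
    (1 - s) + s * c ≤ max 1 c := by
  rcases le_total 1 c with h | h
  · rw [max_eq_right h]; nlinarith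
  · rw [max_eq_left h]; nlinarith

/-- **Staying in the base.**  If `p = (x, y) ∈ Base g` and `(a', b')` has thickening parameter
`b'² − a'^{2g+1} − 1 = t · w(p)` with `0 ≤ t ≤ 1` and `‖a'‖^{2g+1} ≤ max 1 ‖x‖^{2g+1}`, then
`(a', b') ∈ Base g` (`rho = ‖w‖² + eta ‖x‖²` does not increase). [folklore] -/
private theorem mk_mem_baseV (p : Base g) {a' b' : ℂ} {t : ℝ} (ht0 : 0 ≤ t) (ht1 : t ≤ 1)
    (hw : b' ^ 2 - a' ^ (2 * g + 1) - 1 = (t : ℂ) * w g p.1)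
    (ha : ‖a'‖ ^ (2 * g + 1) ≤ max 1 (‖cx p.1‖ ^ (2 * g + 1))) :
    mk a' b' ∈ rho g ⁻¹' Iic (1 / 4 : ℝ) := by
  have hp : rho g p.1 ≤ 1 / 4 := p.2
  rw [mem_preimage, mem_Iic, rho_mkV', hw, norm_mul, Complex.norm_real, Real.norm_eq_abs,
    abs_of_nonneg ht0, mul_pow]
  have h1 : t ^ 2 * ‖w g p.1‖ ^ 2 ≤ ‖w g p.1‖ ^ 2 :=
    mul_le_of_le_one_left (sq_nonneg _) (pow_le_one₀ ht0 ht1)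
  have h2 : eta (‖a'‖ ^ 2) ≤ eta (‖cx p.1‖ ^ 2) := eta_le_of_pow_leV (norm_nonneg _) (norm_nonneg _) ha
  have h3 : rho g p.1 = ‖w g p.1‖ ^ 2 + eta (‖cx p.1‖ ^ 2) := rfl
  linarith

/-- `‖e^{iπ/n}‖ = 1`. [folklore] -/
private theorem norm_halfRootV (n : ℕ) : ‖halfRoot n‖ = 1 := by
  rw [halfRoot, show (Real.pi : ℂ) * Complex.I / n = ((Real.pi / n : ℝ) : ℂ) * Complex.I by
    push_cast; ring, Complex.norm_exp_ofReal_mul_I]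

/-- `‖e^{2πi/n}‖ = 1`. [folklore] -/
private theorem norm_rootUV (n : ℕ) : ‖rootU n‖ = 1 := by
  rw [rootU, show (2 : ℂ) * Real.pi * Complex.I / n = ((2 * Real.pi / n : ℝ) : ℂ) * Complex.I by
    push_cast; ring, Complex.norm_exp_ofReal_mul_I]

/-- `√1 = 1`. [folklore] -/
private theorem csqrt_oneV : csqrt 1 = 1 := Complex.one_cpow _

/-- `√z ≠ 0` for `z ≠ 0`. [folklore] -/
private theorem csqrt_ne_zeroV {z : ℂ} (hz : z ≠ 0) : csqrt z ≠ 0 := fun h => by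
  have := csqrt_sq z; rw [h, zero_pow two_ne_zero] at this; exact hz this.symm

/-- The square root is continuous on the open right half-plane. [folklore] -/
private theorem continuousOn_csqrtV : ContinuousOn csqrt {z : ℂ | 0 < z.re} := fun _ hz =>
  (continuousAt_csqrt (le_of_lt hz)).continuousWithinAt

/-! ## §10 The piece `V` deformation retracts onto the `2g+1` branch points -/

/-- `2g + 1 ≠ 0`. [folklore] -/
theorem odd_ne_zero (g : ℕ) : 2 * g + 1 ≠ 0 := Nat.succ_ne_zero _

/-- On `V`, `Re (−x^{2g+1}) > 1/4 > 0`. [folklore] -/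
theorem re_neg_xPow_gt (p : ↥(𝒱 g)) : 1 / 4 < (-cx p.1.1 ^ (2 * g + 1)).re := by
  have h : (cx p.1.1 ^ (2 * g + 1)).re < -(1 / 4 : ℝ) := p.2
  rw [Complex.neg_re]; linarith

/-- On `V`, `x^{2g+1} ≠ 0`. [folklore] -/
theorem xPow_ne_zero (p : ↥(𝒱 g)) : cx p.1.1 ^ (2 * g + 1) ≠ 0 := fun h => by
  have := re_neg_xPow_gt p; rw [h, neg_zero, Complex.zero_re] at this; linarith

/-- The denominator `ν (−x^{2g+1})^{1/(2g+1)}` does not vanish on `V`. [folklore] -/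
theorem denV_ne_zero (p : ↥(𝒱 g)) : halfRoot (2 * g + 1) * prRoot (2 * g + 1) (-cx p.1.1 ^ (2 * g + 1)) ≠ 0 :=
  mul_ne_zero (halfRoot_ne_zero _) (prRoot_ne_zero (odd_ne_zero g) (neg_ne_zero.2 (xPow_ne_zero p)))

/-- `(ν (−x^{2g+1})^{1/(2g+1)})^{2g+1} = x^{2g+1}`. [folklore] -/
theorem denV_pow (p : ↥(𝒱 g)) :
    (halfRoot (2 * g + 1) * prRoot (2 * g + 1) (-cx p.1.1 ^ (2 * g + 1))) ^ (2 * g + 1) = cx p.1.1 ^ (2 * g + 1) := by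
  rw [mul_pow, halfRoot_pow (odd_ne_zero g), prRoot_pow (odd_ne_zero g)]; ring

/-- **The sector root `angV = x / (ν (−x^{2g+1})^{1/(2g+1)})` on `V`**, a `(2g+1)`-st root of
unity. [folklore] -/
def angV (p : ↥(𝒱 g)) : ℂ := cx p.1.1 / (halfRoot (2 * g + 1) * prRoot (2 * g + 1) (-cx p.1.1 ^ (2 * g + 1)))

/-- `angV^{2g+1} = 1`. [folklore] -/
theorem angV_pow (p : ↥(𝒱 g)) : angV p ^ (2 * g + 1) = 1 := by
  rw [angV, div_pow, denV_pow, div_self (xPow_ne_zero p)]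

/-- `x = angV · ν (−x^{2g+1})^{1/(2g+1)}` on `V`. [folklore] -/
theorem cx_eq_angV_mul (p : ↥(𝒱 g)) :
    cx p.1.1 = angV p * (halfRoot (2 * g + 1) * prRoot (2 * g + 1) (-cx p.1.1 ^ (2 * g + 1))) := by
  rw [angV, div_mul_cancel₀ _ (denV_ne_zero p)]

/-- The sector root is continuous. [folklore] -/
theorem continuous_angV : Continuous (angV (g := g)) := by
  have h1 : Continuous fun p : ↥(𝒱 g) => cx p.1.1 :=
    contDiff_cx.continuous.comp (continuous_subtype_val.comp continuous_subtype_val)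
  have h2 : Continuous fun p : ↥(𝒱 g) => prRoot (2 * g + 1) (-cx p.1.1 ^ (2 * g + 1)) :=
    (continuousOn_prRoot _).comp_continuous ((continuous_xPowV g).comp continuous_subtype_val).neg fun p =>
      lt_trans (by norm_num) (re_neg_xPow_gt p)
  exact h1.div (continuous_const.mul h2) denV_ne_zero

/-- **The index map `V → Fin (2g+1)`.** [folklore] -/
def idxV : C(↥(𝒱 g), Fin (2 * g + 1)) :=
  ⟨fun p => rootIdx (odd_ne_zero g) (angV p),
    continuous_rootIdx_comp (odd_ne_zero g) continuous_angV angV_pow⟩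

/-- The index map in closed form: the exponent of the sector root
`x / (ν (−x^{2g+1})^{1/(2g+1)}) = μ^{idxV}`. [folklore] -/
theorem idxV_apply (p : ↥(𝒱 g)) :
    idxV p = rootIdx (odd_ne_zero g) (cx p.1.1 / (halfRoot (2 * g + 1) * prRoot (2 * g + 1) (-(cx p.1.1 ^ (2 * g + 1))))) :=
  rfl

/-- `(ν μ^k)^{2g+1} = −1`. [folklore] -/
theorem basePtV_pow (g k : ℕ) : (halfRoot (2 * g + 1) * rootU (2 * g + 1) ^ k) ^ (2 * g + 1) = -1 := by
  rw [mul_pow, halfRoot_pow (odd_ne_zero g), rootU_pow_pow (odd_ne_zero g), mul_one]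

/-- The base point `(ν μ^k, 0)` (a branch point of the central page) lies in the base: `rho = 0`.
[folklore] -/
theorem basePtV_mem (g k : ℕ) : mk (halfRoot (2 * g + 1) * rootU (2 * g + 1) ^ k) 0 ∈ rho g ⁻¹' Iic (1 / 4 : ℝ) := by
  rw [mem_preimage, mem_Iic, rho_mkV', basePtV_pow, norm_mul, norm_halfRootV, norm_pow, norm_rootUV, one_pow,
    mul_one, one_pow, eta_of_le (by norm_num)]
  norm_num

/-- The base points lie in `V` (`x^{2g+1} = −1`). [folklore] -/
theorem basePtV_mem_coverV (g k : ℕ) :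
    (⟨mk (halfRoot (2 * g + 1) * rootU (2 * g + 1) ^ k) 0, basePtV_mem g k⟩ : Base g) ∈ 𝒱 g := by
  show (cx (mk _ 0) ^ (2 * g + 1)).re < -(1 / 4 : ℝ)
  rw [cx_mk, basePtV_pow, Complex.neg_re, Complex.one_re]; norm_num

/-- **The section `Fin (2g+1) → V`**, `k ↦ (ν μ^k, 0)`. [folklore] -/
def secV (g : ℕ) : C(Fin (2 * g + 1), ↥(𝒱 g)) :=
  ⟨fun k => ⟨⟨mk (halfRoot (2 * g + 1) * rootU (2 * g + 1) ^ (k : ℕ)) 0, basePtV_mem g k⟩, basePtV_mem_coverV g k⟩,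
    continuous_of_discreteTopology⟩

/-- `x^{2g+1} = −1` at the base points of `V`. [folklore] -/
theorem xPow_secV (k : Fin (2 * g + 1)) : cx (secV g k).1.1 ^ (2 * g + 1) = -1 := by
  show cx (mk _ 0) ^ (2 * g + 1) = -1
  rw [cx_mk, basePtV_pow]

/-- `idx ∘ sec = id` on `V`. [folklore] -/
theorem idxV_secV (k : Fin (2 * g + 1)) : idxV (secV g k) = k := by
  show rootIdx (odd_ne_zero g) (angV (secV g k)) = k
  have h : angV (secV g k) = rootU (2 * g + 1) ^ (k : ℕ) := by
    rw [angV, xPow_secV, neg_neg, prRoot_one, mul_one]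
    show cx (mk _ 0) / _ = _
    rw [cx_mk, mul_div_cancel_left₀ _ (halfRoot_ne_zero _)]
  rw [h, rootIdx_rootU_pow]

/-- The radicand `1 − t²(x^{2g+1} + 1)` of the deformation of `V`. [folklore] -/
def radV (t : ℝ) (p : ↥(𝒱 g)) : ℂ := 1 - (t : ℂ) ^ 2 * (cx p.1.1 ^ (2 * g + 1) + 1)

/-- `Re (1 − t²(x^{2g+1} + 1)) > 1/4` for `t ∈ [0, 1]`. [folklore] -/
theorem re_radV_gt {t : ℝ} (ht0 : 0 ≤ t) (ht1 : t ≤ 1) (p : ↥(𝒱 g)) : 1 / 4 < (radV t p).re := by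
  have hV : (cx p.1.1 ^ (2 * g + 1)).re < -(1 / 4 : ℝ) := p.2
  have ht : 0 ≤ t ^ 2 := sq_nonneg t
  have ht' : t ^ 2 ≤ 1 := pow_le_one₀ ht0 ht1
  rw [radV, ← Complex.ofReal_pow, Complex.sub_re, Complex.one_re, Complex.re_ofReal_mul, Complex.add_re,
    Complex.one_re]
  rcases le_or_gt 0 ((cx p.1.1 ^ (2 * g + 1)).re + 1) with h | h <;> nlinarith

/-- **The deformation of `V`**: `(x, y) ↦ (angV · ν (1 − t²(x^{2g+1} + 1))^{1/(2g+1)}, t y)`.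
[cite: Milnor1968, §9 Lemma 9.2] -/
def defV (t : ℝ) (p : ↥(𝒱 g)) : 𝔼 4 :=
  mk (angV p * (halfRoot (2 * g + 1) * prRoot (2 * g + 1) (radV t p))) ((t : ℂ) * cy p.1.1)

/-- Along the deformation `x^{2g+1} = t²(x^{2g+1} + 1) − 1`. [folklore] -/
theorem defV_xPow (t : ℝ) (p : ↥(𝒱 g)) :
    (angV p * (halfRoot (2 * g + 1) * prRoot (2 * g + 1) (radV t p))) ^ (2 * g + 1) = -radV t p := by
  rw [mul_pow, angV_pow, one_mul, mul_pow, halfRoot_pow (odd_ne_zero g), prRoot_pow (odd_ne_zero g)]; ring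

/-- The deformation stays in the base. [folklore] -/
theorem defV_mem {t : ℝ} (ht0 : 0 ≤ t) (ht1 : t ≤ 1) (p : ↥(𝒱 g)) :
    defV t p ∈ rho g ⁻¹' Iic (1 / 4 : ℝ) := by
  have ht2 : 0 ≤ t ^ 2 := sq_nonneg t
  have ht2' : t ^ 2 ≤ 1 := pow_le_one₀ ht0 ht1
  refine mk_mem_baseV p.1 ht2 ht2' ?_ ?_
  · rw [defV_xPow, radV, mul_pow, ← Complex.ofReal_pow, cy_sq_eqV g]
    show _ = _ * w g p.1.1
    ring
  · rw [← norm_pow, defV_xPow, norm_neg, radV]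
    calc ‖1 - (t : ℂ) ^ 2 * (cx p.1.1 ^ (2 * g + 1) + 1)‖ = ‖(((1 - t ^ 2 : ℝ)) : ℂ) + (-(((t ^ 2 : ℝ)) : ℂ) * cx p.1.1 ^ (2 * g + 1))‖ := by
          congr 1; push_cast; ring
      _ ≤ (1 - t ^ 2) + t ^ 2 * ‖cx p.1.1‖ ^ (2 * g + 1) := by
          refine (norm_add_le _ _).trans ?_
          rw [Complex.norm_real, Real.norm_eq_abs, abs_of_nonneg (by linarith), norm_mul, norm_neg,
            Complex.norm_real, Real.norm_eq_abs, abs_of_nonneg ht2, norm_pow]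
      _ ≤ max 1 (‖cx p.1.1‖ ^ (2 * g + 1)) := convex_comb_le_maxV ht2 ht2'

/-- The deformation stays in `V`. [folklore] -/
theorem defV_mem_coverV {t : ℝ} (ht0 : 0 ≤ t) (ht1 : t ≤ 1) (p : ↥(𝒱 g)) :
    (⟨defV t p, defV_mem ht0 ht1 p⟩ : Base g) ∈ 𝒱 g := by
  show (cx (defV t p) ^ (2 * g + 1)).re < -(1 / 4 : ℝ)
  rw [defV, cx_mk, defV_xPow, Complex.neg_re]
  linarith [re_radV_gt ht0 ht1 p]

/-- The deformation as a map `[0,1] × V → V`. [folklore] -/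
def defVMap (z : unitInterval × ↥(𝒱 g)) : ↥(𝒱 g) :=
  ⟨⟨defV z.1 z.2, defV_mem z.1.2.1 z.1.2.2 z.2⟩, defV_mem_coverV z.1.2.1 z.1.2.2 z.2⟩

/-- The deformation is continuous. [folklore] -/
theorem continuous_defVMap : Continuous (defVMap (g := g)) := by
  refine Continuous.subtype_mk (Continuous.subtype_mk ?_ _) _
  have hs : Continuous fun z : unitInterval × ↥(𝒱 g) => ((z.1 : ℝ) : ℂ) :=
    Complex.continuous_ofReal.comp (continuous_subtype_val.comp continuous_fst)
  have hy : Continuous fun z : unitInterval × ↥(𝒱 g) => cy z.2.1.1 :=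
    contDiff_cy.continuous.comp (continuous_subtype_val.comp (continuous_subtype_val.comp continuous_snd))
  have hP : Continuous fun z : unitInterval × ↥(𝒱 g) => cx z.2.1.1 ^ (2 * g + 1) :=
    (continuous_xPowV g).comp (continuous_subtype_val.comp continuous_snd)
  have hrad : Continuous fun z : unitInterval × ↥(𝒱 g) => radV (z.1 : ℝ) z.2 :=
    continuous_const.sub ((hs.pow 2).mul (hP.add continuous_const))
  have hroot : Continuous fun z : unitInterval × ↥(𝒱 g) => prRoot (2 * g + 1) (radV (z.1 : ℝ) z.2) :=
    (continuousOn_prRoot _).comp_continuous hrad fun z => lt_trans (by norm_num) (re_radV_gt z.1.2.1 z.1.2.2 z.2)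
  have hang : Continuous fun z : unitInterval × ↥(𝒱 g) => angV z.2 := continuous_angV.comp continuous_snd
  exact continuous_mk.comp ((hang.mul (continuous_const.mul hroot)).prodMk (hs.mul hy))

/-- At `t = 1` the deformation is the identity. [folklore] -/
theorem defV_one (p : ↥(𝒱 g)) : defV 1 p = p.1.1 := by
  have h : radV 1 p = -cx p.1.1 ^ (2 * g + 1) := by rw [radV, Complex.ofReal_one, one_pow, one_mul]; ring
  rw [defV, h, ← cx_eq_angV_mul, Complex.ofReal_one, one_mul, mk_cx_cy]

/-- At `t = 0` the deformation is the base point `sec (idx p)`. [folklore] -/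
theorem defV_zero (p : ↥(𝒱 g)) : defV 0 p = (secV g (idxV p)).1.1 := by
  have h : radV 0 p = 1 := by rw [radV, Complex.ofReal_zero, zero_pow two_ne_zero, zero_mul, sub_zero]
  rw [defV, h, prRoot_one, mul_one, Complex.ofReal_zero, zero_mul]
  show mk (angV p * halfRoot (2 * g + 1)) 0 =
    mk (halfRoot (2 * g + 1) * rootU (2 * g + 1) ^ (rootIdx (odd_ne_zero g) (angV p) : ℕ)) 0
  rw [rootU_pow_rootIdx (odd_ne_zero g) (angV_pow p), mul_comm]

/-- **The homotopy `id_V ≃ sec ∘ idx`.** [cite: Milnor1968, §9 Lemma 9.2] -/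
def homotopyV (g : ℕ) : ContinuousMap.Homotopy (ContinuousMap.id ↥(𝒱 g)) ((secV g).comp idxV) where
  toFun z := defVMap (unitInterval.symm z.1, z.2)
  continuous_toFun := continuous_defVMap.comp
    ((unitInterval.continuous_symm.comp continuous_fst).prodMk continuous_snd)
  map_zero_left p := by
    apply Subtype.ext; apply Subtype.ext
    show defV (unitInterval.symm 0 : ℝ) p = p.1.1
    rw [unitInterval.symm_zero, Set.Icc.coe_one, defV_one]
  map_one_left p := by
    apply Subtype.ext; apply Subtype.ext
    show defV (unitInterval.symm 1 : ℝ) p = (secV g (idxV p)).1.1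
    rw [unitInterval.symm_one, Set.Icc.coe_zero, defV_zero]

/-- **`V ≃ Fin (2g+1)`**: the piece `V` of the base is homotopy equivalent to the `2g+1` branch
points. [cite: Milnor1968, §9 Lemma 9.2] -/
def homotopyEquivV (g : ℕ) : ContinuousMap.HomotopyEquiv ↥(𝒱 g) (Fin (2 * g + 1)) where
  toFun := idxV
  invFun := secV g
  left_inv := ⟨(homotopyV g).symm⟩
  right_inv := by
    rw [show idxV.comp (secV g) = ContinuousMap.id (Fin (2 * g + 1)) from ContinuousMap.ext idxV_secV]

/-! ## §11 Radial lifts from the branch points to the axis `x = 0` -/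

/-- The radial lift `r ↦ ((1 − r) ζ, s √(1 − (1 − r)^{2g+1}))` from the branch point `(ζ, 0)`
(`ζ^{2g+1} = −1`) to `(0, s)` (`s² = 1`) runs in the base (on the central page, `‖x‖ ≤ 1`).
[folklore] -/
theorem joined_branchPt_axis (g : ℕ) {ζ s : ℂ} (hζ : ζ ^ (2 * g + 1) = -1) (hζ1 : ‖ζ‖ = 1) (hs : s ^ 2 = 1)
    (h0 : mk ζ 0 ∈ rho g ⁻¹' Iic (1 / 4 : ℝ)) (h1 : mk 0 s ∈ rho g ⁻¹' Iic (1 / 4 : ℝ)) :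
    Joined (⟨mk ζ 0, h0⟩ : Base g) ⟨mk 0 s, h1⟩ := by
  let f : ℝ → 𝔼 4 := fun r => mk ((((1 - r : ℝ)) : ℂ) * ζ) (s * csqrt (((1 - (1 - r) ^ (2 * g + 1) : ℝ)) : ℂ))
  have hmem : ∀ r ∈ Icc (0 : ℝ) 1, f r ∈ rho g ⁻¹' Iic (1 / 4 : ℝ) := by
    intro r ⟨hr0, hr1⟩
    have hw : w g (f r) = 0 := by
      simp only [f, w_eqV', cx_mk, cy_mk]
      rw [mul_pow, hs, one_mul, csqrt_sq, mul_pow, hζ]; push_cast; ring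
    rw [mem_preimage, mem_Iic, rho_eq_zero_of_w_eq_zero g hw]
    · norm_num
    · simp only [f, cx_mk, norm_mul, Complex.norm_real, Real.norm_eq_abs, hζ1, mul_one]
      rw [abs_of_nonneg (by linarith)]; nlinarith
  have hcont : ContinuousOn f (Icc 0 1) := by
    have h1 : Continuous fun r : ℝ => (((1 - r : ℝ)) : ℂ) * ζ := by fun_prop
    have h2 : ContinuousOn (fun r : ℝ => csqrt (((1 - (1 - r) ^ (2 * g + 1) : ℝ)) : ℂ)) (Icc 0 1) := by
      refine ContinuousOn.comp (g := csqrt) (fun z hz => (continuousAt_csqrt hz).continuousWithinAt)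
        (by fun_prop : Continuous fun r : ℝ => (((1 - (1 - r) ^ (2 * g + 1) : ℝ)) : ℂ)).continuousOn ?_
      intro r ⟨hr0, hr1⟩
      show 0 ≤ (((1 - (1 - r) ^ (2 * g + 1) : ℝ)) : ℂ).re
      rw [Complex.ofReal_re, sub_nonneg]
      exact pow_le_one₀ (by linarith) (by linarith)
    exact continuous_mk.comp_continuousOn (h1.continuousOn.prodMk (continuousOn_const.mul h2))
  refine ⟨⟨⟨fun r => ⟨f r, hmem r r.2⟩, ?_⟩, ?_, ?_⟩⟩
  · exact (hcont.comp_continuous continuous_subtype_val fun r => r.2).subtype_mk _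
  · apply Subtype.ext
    show f 0 = mk ζ 0
    simp [f]
  · apply Subtype.ext
    show f 1 = mk 0 s
    simp [f, csqrt_oneV]

end LefschetzBase

end Literature.Topology.FourManifolds
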